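import Literature.Analysis.Convolution.ConvolutionPowerDiscretization
import HarnessLib

/-!
# Discrete convolution powers in exact integer arithmetic

Topic `Literature/Analysis/Convolution`, namespace `Literature.Analysis.Convolution` (sequel of
`ConvolutionPowerDiscretization`, which defines the product formula `dconv` and the convolution powers
`dconvPow p n m = [x^m](Σ_j p_j x^j)^n` [cite: GathenGerhard2013ModernComputerAlgebra, §2.3 (4)]).  Everything
here is PROVED; standard axioms; no measure theory.

This file is the soundness layer between a certificate *computed with natural numbers* and an inequality
`Σ_{m<M} (p^{∗n})_m ≤ C` (or `≥`) about the real convolution powers of a non-negative sequence `p` (in the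
application: lattice cell masses of a density, `ConvolutionPowerDiscretization`, `PolymathProductHoeffding`).

* Homogeneity and slot locality (§2.3 (4)): `(c p)^{∗n} = cⁿ p^{∗n}` (`dconvPow_const_mul`); the slots `m < M` of
  `p^{∗n}` only see `p_j, j < M` (`dconvPow_congr_of_le`, `dconvPow_truncSeq`).
* Addition-chain steps with one-sided hypotheses on the slots `m < M` only (`dconvPow_add_le_dconv`,
  `dconv_le_dconvPow_add`): from `p^{∗a} ≤ U`, `p^{∗b} ≤ V` slotwise, `p^{∗(a+b)} ≤ U ⋆ V` — the product formula is
  monotone.  With FIXED-POINT vectors `U = u/D`, `V = v/E` (`u, v : ℕ → ℕ`) the product is the integer product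
  formula `dconvNat u v/(DE)` (`dconv_div_div`), and DIRECTED ROUNDING back to scale `D` is sound:
  `p^{∗(a+b)}_m ≤ ⌈(u ⋆ v)_m/E⌉/D` (`dconvPow_add_le_ceilDiv`), `⌊(u ⋆ v)_m/E⌋/D ≤ p^{∗(a+b)}_m`
  (`floorDiv_le_dconvPow_add`); so a chain `1 = n₀, …, n_r = n` of vectors computed in ℕ by products and
  directed renormalisations bounds `p^{∗n}` slotwise, hence `Σ_{m<M} p^{∗n}_m` (`sum_dconvPow_le_cast_div`).
* Size control (no carries): `(u ⋆ v)_m ≤ (Σ u)(Σ v)` and `Σ_m (u↾M ⋆ v↾M)_m = (Σ_{j<M} u_j)(Σ_{j<M} v_j)`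
  (`dconvNat_truncSeq_le`, `sum_dconvNat_truncSeq`).
* KRONECKER SUBSTITUTION [cite: GathenGerhard2013ModernComputerAlgebra, §8.4 (Kronecker substitution)]: packing the
  slots `j < M` as the integer `kpack B M d = Σ_{j<M} d_j 2^{Bj}` (the value of `Σ d_j x^j` at `x = 2^B`) turns the
  product formula into ONE integer multiplication, `kpack B M d · kpack B M e = kpack B (2M) (d↾M ⋆ e↾M)`
  (`kpack_mul_kpack`), and when every coefficient is `< 2^B` the coefficients are read off the `2^B`-adic digits
  (`kdigit_kpack`, `kdigit_kpack_mul_kpack`); low slots are kept by reduction mod `2^{BM}` (`kpack_mod_two_pow`), and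
  the SUM of the slots is read off by one reduction modulo `2^B − 1`, since `2^B ≡ 1` (`kpack_modEq_sum`,
  `kpack_mod_eq_sum`) — so a partial sum `Σ_{m<M} c_m` of a packed vector costs two big-integer remainders.

* Digitwise operations at the bit level: the bits of a packed vector (`testBit_kpack`), linearity
  (`kpack_add_kpack`), and the PERIODIC-MASK RENORMALISATION `((kpack B M c) >>> L) &&& Σ_m (2^{B−L}−1)2^{Bm}
  = kpack B M (⌊c_m/2^L⌋)` (`shiftRight_kpack_land_mask`) — one shift and one AND divide every slot by `2^L`.

* One addition-chain step as big-integer operations (`kpack_mul_step_floor`, `kpack_mul_step_ceil`): product,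
  truncation `mod 2^{BM}`, (addition of the rounding constant,) shift-and-mask = `kpack` of the slotwise rounded
  integer product formula, under the single no-carry condition `(Σu)(Σv) (+ 2^L) ≤ 2^B`; and the a-priori slot-sum
  bounds after a step (`sum_floorStep_le`, `sum_ceilStep_le`) that keep that condition checkable along a chain.

* Divide-and-conquer packing `kpackDC` (= `kpack`, `kpackDC_zero_eq`; the initial vector in `O(M log M)` work) and
  the regrouping of a block-constant weight against a packed vector (`sum_range_mul_blockConst`: `r` blocks cost
  `r + 1` partial sums).

How the big-integer operations are scheduled (addition chain, slot count, digit width `B`, fixed-point scale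
`2^L`) is left to the certificate checker; the statements here are layout-agnostic.
-/

open Finset

namespace Literature.Analysis.Convolution

/-! ### Homogeneity and slot locality of convolution powers -/

section Locality

variable {α : Type*} [Zero α]

/-- `(c·a) ⋆ b = c·(a ⋆ b)` (bilinearity of the product formula (4)).
[cite: GathenGerhard2013ModernComputerAlgebra, §2.3 (4)] -/
theorem dconv_const_mul_left (c : ℝ) (a b : ℕ → ℝ) (m : ℕ) :
    dconv (fun i => c * a i) b m = c * dconv a b m := by
  simp only [dconv, Finset.mul_sum]
  exact Finset.sum_congr rfl fun ij _ => by ring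

/-- **Homogeneity** `(c·p)^{∗n} = cⁿ·p^{∗n}` (iterate (4)); used to normalise cell masses by the total mass before
packing them as fixed-point integers. [cite: GathenGerhard2013ModernComputerAlgebra, §2.3 (4)] -/
theorem dconvPow_const_mul (c : ℝ) (p : ℕ → ℝ) (n : ℕ) :
    ∀ m, dconvPow (fun j => c * p j) n m = c ^ n * dconvPow p n m := by
  induction n with
  | zero => intro m; simp [dconvPow_zero]
  | succ n ih =>
      intro m
      rw [dconvPow_succ, dconvPow_succ]
      simp only [dconv, ih, Finset.mul_sum]
      exact Finset.sum_congr rfl fun ij _ => by ring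

/-- Truncation of a sequence to its slots `j < M` (`a↾M`). [cite: GathenGerhard2013ModernComputerAlgebra, §8.4 (polynomials of degree less than n)] -/
def truncSeq (M : ℕ) (a : ℕ → α) (j : ℕ) : α := if j < M then a j else 0

omit [Zero α] in
/-- `a↾M` agrees with `a` below `M`. [cite: GathenGerhard2013ModernComputerAlgebra, §8.4 (polynomials of degree less than n)] -/
@[simp] theorem truncSeq_of_lt [Zero α] (a : ℕ → α) {M j : ℕ} (h : j < M) : truncSeq M a j = a j :=
  if_pos h

omit [Zero α] in
/-- `a↾M` vanishes from `M` on. [cite: GathenGerhard2013ModernComputerAlgebra, §8.4 (polynomials of degree less than n)] -/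
@[simp] theorem truncSeq_of_le [Zero α] (a : ℕ → α) {M j : ℕ} (h : M ≤ j) : truncSeq M a j = 0 :=
  if_neg (not_lt.2 h)

/-- **Slot locality of (4)**: `(a ⋆ b)_m` depends only on `a_i, b_j` with `i, j ≤ m`.
[cite: GathenGerhard2013ModernComputerAlgebra, §2.3 (4)] -/
theorem dconv_congr_of_le {a a' b b' : ℕ → ℝ} {m : ℕ} (ha : ∀ i ≤ m, a i = a' i)
    (hb : ∀ j ≤ m, b j = b' j) : dconv a b m = dconv a' b' m := by
  refine Finset.sum_congr rfl fun ij hij => ?_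
  rw [Finset.mem_antidiagonal] at hij
  rw [ha ij.1 (by omega), hb ij.2 (by omega)]

/-- Slot locality of convolution powers: `(p^{∗n})_m` depends only on `p_j, j ≤ m`.
[cite: GathenGerhard2013ModernComputerAlgebra, §2.3 (4)] -/
theorem dconvPow_congr_of_le {p p' : ℕ → ℝ} (n : ℕ) :
    ∀ {m : ℕ}, (∀ j ≤ m, p j = p' j) → dconvPow p n m = dconvPow p' n m := by
  induction n with
  | zero => intro m _; rw [dconvPow_zero, dconvPow_zero]
  | succ n ih =>
      intro m hm
      rw [dconvPow_succ, dconvPow_succ]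
      exact dconv_congr_of_le hm fun j hj => ih fun i hi => hm i (hi.trans hj)

/-- The slots `m < M` of `p^{∗n}` are those of `(p↾M)^{∗n}`: a certificate may work with the finite vector
`(p_j)_{j<M}`. [cite: GathenGerhard2013ModernComputerAlgebra, §2.3 (4)] -/
theorem dconvPow_truncSeq (p : ℕ → ℝ) (n : ℕ) {M m : ℕ} (hm : m < M) :
    dconvPow (truncSeq M p) n m = dconvPow p n m :=
  dconvPow_congr_of_le n fun _ hj => truncSeq_of_lt p (lt_of_le_of_lt hj hm)

end Locality

/-! ### Addition-chain steps with slotwise one-sided bounds -/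

section Chain

variable {p : ℕ → ℝ} {U V : ℕ → ℝ} {a b M : ℕ}

/-- **Upper chain step.**  If `p ≥ 0`, `p^{∗a} ≤ U` and `p^{∗b} ≤ V` on the slots `< M`, then
`p^{∗(a+b)} ≤ U ⋆ V` on the slots `< M` (semigroup law + monotonicity of (4)).
[cite: GathenGerhard2013ModernComputerAlgebra, §2.3 (4)] -/
theorem dconvPow_add_le_dconv (hp : ∀ j, 0 ≤ p j) (hU : ∀ m < M, dconvPow p a m ≤ U m)
    (hV : ∀ m < M, dconvPow p b m ≤ V m) : ∀ m < M, dconvPow p (a + b) m ≤ dconv U V m := by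
  intro m hm
  rw [dconvPow_add]
  refine Finset.sum_le_sum fun ij hij => ?_
  rw [Finset.mem_antidiagonal] at hij
  exact mul_le_mul (hU ij.1 (by omega)) (hV ij.2 (by omega)) (dconvPow_nonneg hp _ _)
    ((dconvPow_nonneg hp _ _).trans (hU ij.1 (by omega)))

/-- **Lower chain step.**  If `p ≥ 0`, `0 ≤ V`, `U ≤ p^{∗a}` and `V ≤ p^{∗b}` on the slots `< M`, then
`U ⋆ V ≤ p^{∗(a+b)}` on the slots `< M`. [cite: GathenGerhard2013ModernComputerAlgebra, §2.3 (4)] -/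
theorem dconv_le_dconvPow_add (hp : ∀ j, 0 ≤ p j) (hV0 : ∀ m, 0 ≤ V m)
    (hU : ∀ m < M, U m ≤ dconvPow p a m) (hV : ∀ m < M, V m ≤ dconvPow p b m) :
    ∀ m < M, dconv U V m ≤ dconvPow p (a + b) m := by
  intro m hm
  rw [dconvPow_add]
  refine Finset.sum_le_sum fun ij hij => ?_
  rw [Finset.mem_antidiagonal] at hij
  exact mul_le_mul (hU ij.1 (by omega)) (hV ij.2 (by omega)) (hV0 _) (dconvPow_nonneg hp _ _)

end Chain

/-! ### The integer product formula and fixed-point rounding -/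

section NatVectors

/-- The product formula (4) for ℕ-valued sequences: `(u ⋆ v)_m = Σ_{i+j=m} u_i v_j`.
[cite: GathenGerhard2013ModernComputerAlgebra, §2.3 (4)] -/
def dconvNat (u v : ℕ → ℕ) (m : ℕ) : ℕ := ∑ ij ∈ antidiagonal m, u ij.1 * v ij.2

/-- `(u ⋆ v)` over ℕ, cast to ℝ, is `dconv` of the casts. [cite: GathenGerhard2013ModernComputerAlgebra, §2.3 (4)] -/
theorem cast_dconvNat (u v : ℕ → ℕ) (m : ℕ) :
    ((dconvNat u v m : ℕ) : ℝ) = dconv (fun i => (u i : ℝ)) (fun j => (v j : ℝ)) m := by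
  simp [dconvNat, dconv]

/-- Fixed-point vectors multiply through the integer product formula: `(u/D) ⋆ (v/E) = (u ⋆ v)/(DE)`.
[cite: GathenGerhard2013ModernComputerAlgebra, §2.3 (4)] -/
theorem dconv_div_div (u v : ℕ → ℕ) (D E : ℝ) (m : ℕ) :
    dconv (fun i => (u i : ℝ) / D) (fun j => (v j : ℝ) / E) m = (dconvNat u v m : ℝ) / (D * E) := by
  rw [cast_dconvNat, dconv, dconv, Finset.sum_div]
  exact Finset.sum_congr rfl fun ij _ => by rw [div_mul_div_comm]

/-- Rounding a quotient UP in ℕ: `x ≤ E·⌈x/E⌉` with `⌈x/E⌉ = (x + E − 1)/E`. [cite: GathenGerhard2013ModernComputerAlgebra, §2.4 (division with remainder)] -/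
theorem le_mul_ceilDiv (x : ℕ) {E : ℕ} (hE : 0 < E) : x ≤ E * ((x + E - 1) / E) := by
  have h1 := Nat.div_add_mod (x + E - 1) E
  have h2 := Nat.mod_lt (x + E - 1) hE
  omega

/-- Directed rounding, upper: `x/(DE) ≤ ⌈x/E⌉/D`. [cite: GathenGerhard2013ModernComputerAlgebra, §2.4 (division with remainder)] -/
theorem cast_div_mul_le_ceilDiv_div (x : ℕ) {D E : ℕ} (hD : 0 < D) (hE : 0 < E) :
    (x : ℝ) / ((D : ℝ) * E) ≤ (((x + E - 1) / E : ℕ) : ℝ) / D := by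
  have hD' : (0 : ℝ) < D := Nat.cast_pos.2 hD
  have hE' : (0 : ℝ) < E := Nat.cast_pos.2 hE
  rw [le_div_iff₀ hD', div_mul_eq_mul_div, div_le_iff₀ (mul_pos hD' hE')]
  have h' : (x : ℝ) ≤ (E : ℝ) * (((x + E - 1) / E : ℕ) : ℝ) := by exact_mod_cast le_mul_ceilDiv x hE
  calc (x : ℝ) * D ≤ (E : ℝ) * (((x + E - 1) / E : ℕ) : ℝ) * D := mul_le_mul_of_nonneg_right h' hD'.le
    _ = (((x + E - 1) / E : ℕ) : ℝ) * ((D : ℝ) * E) := by ring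

/-- Directed rounding, lower: `⌊x/E⌋/D ≤ x/(DE)`. [cite: GathenGerhard2013ModernComputerAlgebra, §2.4 (division with remainder)] -/
theorem floorDiv_div_le_cast_div_mul (x : ℕ) {D E : ℕ} (hD : 0 < D) (hE : 0 < E) :
    (((x / E : ℕ) : ℕ) : ℝ) / D ≤ (x : ℝ) / ((D : ℝ) * E) := by
  have hD' : (0 : ℝ) < D := Nat.cast_pos.2 hD
  have hE' : (0 : ℝ) < E := Nat.cast_pos.2 hE
  rw [div_le_iff₀ hD', div_mul_eq_mul_div, le_div_iff₀ (mul_pos hD' hE')]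
  have h' : (E : ℝ) * ((x / E : ℕ) : ℝ) ≤ x := by exact_mod_cast Nat.mul_div_le x E
  calc ((x / E : ℕ) : ℝ) * ((D : ℝ) * E) = (E : ℝ) * ((x / E : ℕ) : ℝ) * D := by ring
    _ ≤ (x : ℝ) * D := mul_le_mul_of_nonneg_right h' hD'.le

variable {p : ℕ → ℝ} {u v : ℕ → ℕ} {a b M D E : ℕ}

/-- **Upper chain step in fixed point.**  `p ≥ 0`, `p^{∗a} ≤ u/D`, `p^{∗b} ≤ v/E` on the slots `< M` ⇒
`p^{∗(a+b)}_m ≤ ⌈(u ⋆ v)_m/E⌉/D` on the slots `< M` — the product formula in ℕ followed by rounding UP back to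
scale `D`. [cite: GathenGerhard2013ModernComputerAlgebra, §2.3 (4)] -/
theorem dconvPow_add_le_ceilDiv (hp : ∀ j, 0 ≤ p j) (hD : 0 < D) (hE : 0 < E)
    (hu : ∀ m < M, dconvPow p a m ≤ (u m : ℝ) / D) (hv : ∀ m < M, dconvPow p b m ≤ (v m : ℝ) / E) :
    ∀ m < M, dconvPow p (a + b) m ≤ (((dconvNat u v m + E - 1) / E : ℕ) : ℝ) / D := by
  intro m hm
  refine (dconvPow_add_le_dconv hp hu hv m hm).trans ?_
  rw [dconv_div_div]
  exact cast_div_mul_le_ceilDiv_div _ hD hE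

/-- **Lower chain step in fixed point.**  `p ≥ 0`, `u/D ≤ p^{∗a}`, `v/E ≤ p^{∗b}` on the slots `< M` ⇒
`⌊(u ⋆ v)_m/E⌋/D ≤ p^{∗(a+b)}_m` on the slots `< M` — the product formula in ℕ followed by rounding DOWN.
[cite: GathenGerhard2013ModernComputerAlgebra, §2.3 (4)] -/
theorem floorDiv_le_dconvPow_add (hp : ∀ j, 0 ≤ p j) (hD : 0 < D) (hE : 0 < E)
    (hu : ∀ m < M, (u m : ℝ) / D ≤ dconvPow p a m) (hv : ∀ m < M, (v m : ℝ) / E ≤ dconvPow p b m) :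
    ∀ m < M, (((dconvNat u v m) / E : ℕ) : ℝ) / D ≤ dconvPow p (a + b) m := by
  intro m hm
  refine le_trans ?_ (dconv_le_dconvPow_add hp (fun j => by positivity) hu hv m hm)
  rw [dconv_div_div]
  exact floorDiv_div_le_cast_div_mul _ hD hE

/-- Summing slotwise fixed-point upper bounds: `Σ_{m<M} p^{∗n}_m ≤ (Σ_{m<M} w_m)/D`.
[cite: GathenGerhard2013ModernComputerAlgebra, §2.3 (4)] -/
theorem sum_dconvPow_le_cast_div {w : ℕ → ℕ} {n : ℕ} (hw : ∀ m < M, dconvPow p n m ≤ (w m : ℝ) / D) :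
    ∑ m ∈ range M, dconvPow p n m ≤ ((∑ m ∈ range M, w m : ℕ) : ℝ) / D := by
  rw [Nat.cast_sum, Finset.sum_div]
  exact Finset.sum_le_sum fun m hm => hw m (Finset.mem_range.1 hm)

/-- Summing weighted slotwise fixed-point lower bounds (`ℓ ≥ 0`): `Σ_{m<M} ℓ_m w_m/D ≤ Σ_{m<M} ℓ_m p^{∗n}_m`.
[cite: GathenGerhard2013ModernComputerAlgebra, §2.3 (4)] -/
theorem sum_mul_cast_div_le_sum_mul_dconvPow {w : ℕ → ℕ} {ℓ : ℕ → ℝ} {n : ℕ} (hℓ : ∀ m, 0 ≤ ℓ m)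
    (hw : ∀ m < M, (w m : ℝ) / D ≤ dconvPow p n m) :
    ∑ m ∈ range M, ℓ m * ((w m : ℝ) / D) ≤ ∑ m ∈ range M, ℓ m * dconvPow p n m :=
  Finset.sum_le_sum fun m hm => mul_le_mul_of_nonneg_left (hw m (Finset.mem_range.1 hm)) (hℓ m)

end NatVectors

/-! ### Size of the coefficients (no-carry conditions) -/

section Size

/-- `⋃_{m<N} {(i,j) : i+j = m} = {(i,j) ∈ [0,N)² : i + j < N}`. [folklore] -/
private theorem biUnion_range_antidiagonal_nat (N : ℕ) :
    (range N).biUnion (fun m => antidiagonal m) =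
      ((range N) ×ˢ (range N)).filter (fun ij : ℕ × ℕ => ij.1 + ij.2 < N) := by
  ext ⟨i, j⟩
  simp only [Finset.mem_biUnion, Finset.mem_range, Finset.mem_antidiagonal, Finset.mem_filter,
    Finset.mem_product]
  constructor
  · rintro ⟨m, hm, hij⟩
    refine ⟨⟨?_, ?_⟩, ?_⟩ <;> omega
  · rintro ⟨-, h⟩
    exact ⟨i + j, h, rfl⟩

/-- `Σ_{m<N} Σ_{i+j=m} F(i,j) = Σ over {(i,j) ∈ [0,N)² : i+j<N}`. [folklore] -/
private theorem sum_range_sum_antidiagonal_eq_sum_filter_nat {β : Type*} [AddCommMonoid β]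
    (F : ℕ × ℕ → β) (N : ℕ) :
    ∑ m ∈ range N, ∑ ij ∈ antidiagonal m, F ij =
      ∑ ij ∈ ((range N) ×ˢ (range N)).filter (fun ij : ℕ × ℕ => ij.1 + ij.2 < N), F ij := by
  rw [← biUnion_range_antidiagonal_nat, Finset.sum_biUnion]
  intro m _ m' _ hmm'
  simp only [Function.onFun]
  rw [Finset.disjoint_left]
  intro ij h1 h2
  rw [Finset.mem_antidiagonal] at h1 h2
  exact hmm' (h1.symm.trans h2)

/-- The weighted coefficient identity behind Kronecker substitution: for sequences truncated to `M` slots,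
`Σ_{m<2M} Σ_{i+j=m} f_i g_j w(m) = Σ_{i<M} Σ_{j<M} f_i g_j w(i+j)`. [cite: GathenGerhard2013ModernComputerAlgebra, §8.4 (h = fg, h_k = Σ_{i+j=k} f_i g_j)] -/
theorem sum_antidiagonal_truncSeq_eq {β : Type*} [CommSemiring β] (f g : ℕ → β) (w : ℕ → β) (M : ℕ) :
    ∑ m ∈ range (2 * M), ∑ ij ∈ antidiagonal m, truncSeq M f ij.1 * truncSeq M g ij.2 * w m =
      ∑ i ∈ range M, ∑ j ∈ range M, f i * g j * w (i + j) := by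
  have hsub : (range M) ×ˢ (range M) ⊆
      ((range (2 * M)) ×ˢ (range (2 * M))).filter (fun ij : ℕ × ℕ => ij.1 + ij.2 < 2 * M) := by
    intro ij hij
    simp only [Finset.mem_product, Finset.mem_range, Finset.mem_filter] at hij ⊢
    omega
  calc ∑ m ∈ range (2 * M), ∑ ij ∈ antidiagonal m, truncSeq M f ij.1 * truncSeq M g ij.2 * w m
      = ∑ m ∈ range (2 * M), ∑ ij ∈ antidiagonal m,
          truncSeq M f ij.1 * truncSeq M g ij.2 * w (ij.1 + ij.2) := by
        refine Finset.sum_congr rfl fun m _ => Finset.sum_congr rfl fun ij hij => ?_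
        rw [Finset.mem_antidiagonal] at hij
        rw [hij]
    _ = ∑ ij ∈ ((range (2 * M)) ×ˢ (range (2 * M))).filter (fun ij : ℕ × ℕ => ij.1 + ij.2 < 2 * M),
          truncSeq M f ij.1 * truncSeq M g ij.2 * w (ij.1 + ij.2) :=
        sum_range_sum_antidiagonal_eq_sum_filter_nat _ _
    _ = ∑ ij ∈ (range M) ×ˢ (range M), truncSeq M f ij.1 * truncSeq M g ij.2 * w (ij.1 + ij.2) := by
        refine (Finset.sum_subset hsub fun ij _ hnot => ?_).symm
        simp only [Finset.mem_product, Finset.mem_range, not_and_or, not_lt] at hnot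
        rcases hnot with h | h
        · rw [truncSeq_of_le f h, zero_mul, zero_mul]
        · rw [truncSeq_of_le g h, mul_zero, zero_mul]
    _ = ∑ i ∈ range M, ∑ j ∈ range M, f i * g j * w (i + j) := by
        rw [← Finset.sum_product']
        refine Finset.sum_congr rfl fun ij hij => ?_
        rw [Finset.mem_product, Finset.mem_range, Finset.mem_range] at hij
        rw [truncSeq_of_lt f hij.1, truncSeq_of_lt g hij.2]

/-- **Total mass is multiplicative**: `Σ_{m<2M} (u↾M ⋆ v↾M)_m = (Σ_{j<M} u_j)(Σ_{j<M} v_j)` (the value of `h = fg` at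
`x = 1`). [cite: GathenGerhard2013ModernComputerAlgebra, §8.4 (h = fg, h_k = Σ_{i+j=k} f_i g_j)] -/
theorem sum_dconvNat_truncSeq (u v : ℕ → ℕ) (M : ℕ) :
    ∑ m ∈ range (2 * M), dconvNat (truncSeq M u) (truncSeq M v) m =
      (∑ i ∈ range M, u i) * (∑ j ∈ range M, v j) := by
  have h := sum_antidiagonal_truncSeq_eq u v (fun _ => (1 : ℕ)) M
  simp only [mul_one] at h
  unfold dconvNat
  rw [h, Finset.sum_mul_sum]

/-- **No-carry bound**: every coefficient of `u↾M ⋆ v↾M` is at most `(Σ_{j<M} u_j)(Σ_{j<M} v_j)` (cf. the bound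
`0 ≤ h_k < n 2^{128 l}` of the source). [cite: GathenGerhard2013ModernComputerAlgebra, §8.4 (Kronecker substitution)] -/
theorem dconvNat_truncSeq_le (u v : ℕ → ℕ) (M m : ℕ) :
    dconvNat (truncSeq M u) (truncSeq M v) m ≤ (∑ i ∈ range M, u i) * (∑ j ∈ range M, v j) := by
  by_cases hm : m < 2 * M
  · rw [← sum_dconvNat_truncSeq]
    exact Finset.single_le_sum (f := fun m => dconvNat (truncSeq M u) (truncSeq M v) m)
      (fun _ _ => Nat.zero_le _) (Finset.mem_range.2 hm)
  · refine le_of_eq_of_le ?_ (Nat.zero_le _)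
    refine Finset.sum_eq_zero fun ij hij => ?_
    rw [Finset.mem_antidiagonal] at hij
    by_cases hi : ij.1 < M
    · rw [truncSeq_of_le v (show M ≤ ij.2 by omega), mul_zero]
    · rw [truncSeq_of_le u (not_lt.1 hi), zero_mul]

/-- Slotwise no-carry bound without truncation, on the slots `m < M`: `(u ⋆ v)_m ≤ (Σ_{j<M} u_j)(Σ_{j<M} v_j)`.
[cite: GathenGerhard2013ModernComputerAlgebra, §8.4 (Kronecker substitution)] -/
theorem dconvNat_le_sum_mul_sum (u v : ℕ → ℕ) {M m : ℕ} (hm : m < M) :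
    dconvNat u v m ≤ (∑ i ∈ range M, u i) * (∑ j ∈ range M, v j) := by
  rw [dconvNat, Finset.sum_mul_sum, ← Finset.sum_product']
  refine Finset.sum_le_sum_of_subset_of_nonneg ?_ (fun _ _ _ => Nat.zero_le _)
  intro ij hij
  rw [Finset.mem_antidiagonal] at hij
  rw [Finset.mem_product, Finset.mem_range, Finset.mem_range]
  omega

/-- Slot locality of the integer product formula: `(u ⋆ v)_m` depends only on `u_i, v_j`, `i, j ≤ m`.
[cite: GathenGerhard2013ModernComputerAlgebra, §2.3 (4)] -/
theorem dconvNat_congr_of_le {u u' v v' : ℕ → ℕ} {m : ℕ} (hu : ∀ i ≤ m, u i = u' i)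
    (hv : ∀ j ≤ m, v j = v' j) : dconvNat u v m = dconvNat u' v' m := by
  refine Finset.sum_congr rfl fun ij hij => ?_
  rw [Finset.mem_antidiagonal] at hij
  rw [hu ij.1 (by omega), hv ij.2 (by omega)]

/-- On the slots `m < M`, `u↾M ⋆ v↾M = u ⋆ v`. [cite: GathenGerhard2013ModernComputerAlgebra, §2.3 (4)] -/
theorem dconvNat_truncSeq_of_lt (u v : ℕ → ℕ) {M m : ℕ} (hm : m < M) :
    dconvNat (truncSeq M u) (truncSeq M v) m = dconvNat u v m :=
  dconvNat_congr_of_le (fun _ hi => truncSeq_of_lt u (by omega)) (fun _ hj => truncSeq_of_lt v (by omega))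

/-- **A-priori mass bound** for a product step: `Σ_{m<M} (u ⋆ v)_m ≤ (Σ_{j<M} u_j)(Σ_{j<M} v_j)` (keeps digit sums
below `2^B − 1` along a chain without evaluating slots). [cite: GathenGerhard2013ModernComputerAlgebra, §8.4 (Kronecker substitution)] -/
theorem sum_dconvNat_le (u v : ℕ → ℕ) (M : ℕ) :
    ∑ m ∈ range M, dconvNat u v m ≤ (∑ i ∈ range M, u i) * (∑ j ∈ range M, v j) := by
  calc ∑ m ∈ range M, dconvNat u v m = ∑ m ∈ range M, dconvNat (truncSeq M u) (truncSeq M v) m :=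
        Finset.sum_congr rfl fun m hm => (dconvNat_truncSeq_of_lt u v (Finset.mem_range.1 hm)).symm
    _ ≤ ∑ m ∈ range (2 * M), dconvNat (truncSeq M u) (truncSeq M v) m :=
        Finset.sum_le_sum_of_subset_of_nonneg (Finset.range_mono (by omega)) fun _ _ _ => Nat.zero_le _
    _ = (∑ i ∈ range M, u i) * (∑ j ∈ range M, v j) := sum_dconvNat_truncSeq u v M

end Size

/-! ### Kronecker substitution: packed vectors, their products, digits and digit sums -/

section Kronecker

/-- **Kronecker packing** of the slots `j < M` of `d` in base `2^B`: `Σ_{j<M} d_j 2^{Bj}`, the value at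
`x = 2^B` of the polynomial `Σ_{j<M} d_j x^j`. [cite: GathenGerhard2013ModernComputerAlgebra, §8.4 (Kronecker substitution)] -/
def kpack (B M : ℕ) (d : ℕ → ℕ) : ℕ := ∑ j ∈ range M, d j * 2 ^ (B * j)

/-- The `m`-th base-`2^B` digit of `N`. [cite: GathenGerhard2013ModernComputerAlgebra, §8.4 (the 2^{64t}-adic representation)] -/
def kdigit (B N m : ℕ) : ℕ := N / 2 ^ (B * m) % 2 ^ B

/-- `kpack B 0 d = 0`. [cite: GathenGerhard2013ModernComputerAlgebra, §8.4 (Kronecker substitution)] -/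
@[simp] theorem kpack_zero (B : ℕ) (d : ℕ → ℕ) : kpack B 0 d = 0 := by
  simp [kpack]

/-- `kpack B (M+1) d = kpack B M d + d_M 2^{BM}`. [cite: GathenGerhard2013ModernComputerAlgebra, §8.4 (Kronecker substitution)] -/
theorem kpack_succ (B M : ℕ) (d : ℕ → ℕ) : kpack B (M + 1) d = kpack B M d + d M * 2 ^ (B * M) := by
  simp [kpack, Finset.sum_range_succ]

/-- `kpack B 1 d = d_0`. [cite: GathenGerhard2013ModernComputerAlgebra, §8.4 (Kronecker substitution)] -/
@[simp] theorem kpack_one (B : ℕ) (d : ℕ → ℕ) : kpack B 1 d = d 0 := by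
  simp [kpack]

/-- **Linearity**: `kpack B M c + kpack B M c' = kpack B M (c + c')` (unconditionally; e.g. adding the periodic constant
`Σ_m (2^L − 1) 2^{Bm}` before a digitwise division rounds every slot UP). [cite: GathenGerhard2013ModernComputerAlgebra, §8.4 (Kronecker substitution)] -/
theorem kpack_add_kpack (B M : ℕ) (c c' : ℕ → ℕ) :
    kpack B M c + kpack B M c' = kpack B M (fun m => c m + c' m) := by
  unfold kpack
  rw [← Finset.sum_add_distrib]
  exact Finset.sum_congr rfl fun m _ => by ring

/-- Splitting a packed vector: `kpack B (m+r) d = kpack B m d + 2^{Bm} · kpack B r (d(m+·))`.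
[cite: GathenGerhard2013ModernComputerAlgebra, §8.4 (Kronecker substitution)] -/
theorem kpack_add (B m r : ℕ) (d : ℕ → ℕ) :
    kpack B (m + r) d = kpack B m d + 2 ^ (B * m) * kpack B r (fun i => d (m + i)) := by
  induction r with
  | zero => simp
  | succ r ih =>
      rw [← add_assoc, kpack_succ, ih, kpack_succ]
      ring

/-- Low-slot-first splitting: `kpack B (M+1) d = 2^B · kpack B M (d(1+·)) + d_0`.
[cite: GathenGerhard2013ModernComputerAlgebra, §8.4 (Kronecker substitution)] -/
theorem kpack_succ' (B M : ℕ) (d : ℕ → ℕ) :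
    kpack B (M + 1) d = 2 ^ B * kpack B M (fun i => d (1 + i)) + d 0 := by
  rw [show M + 1 = 1 + M from add_comm M 1, kpack_add, kpack_one, mul_one, add_comm]

/-- A packed vector with digits `< 2^B` is `< 2^{BM}`. [cite: GathenGerhard2013ModernComputerAlgebra, §8.4 (Kronecker substitution)] -/
theorem kpack_lt {B M : ℕ} {d : ℕ → ℕ} (hd : ∀ j < M, d j < 2 ^ B) : kpack B M d < 2 ^ (B * M) := by
  induction M with
  | zero => simp
  | succ M ih =>
      rw [kpack_succ]
      have h1 := ih fun j hj => hd j (by omega)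
      have h2 : d M + 1 ≤ 2 ^ B := hd M (by omega)
      have h3 : 2 ^ (B * (M + 1)) = 2 ^ B * 2 ^ (B * M) := by
        rw [mul_add, mul_one, pow_add, mul_comm]
      rw [h3]
      calc kpack B M d + d M * 2 ^ (B * M) < 2 ^ (B * M) + d M * 2 ^ (B * M) := by omega
        _ = (d M + 1) * 2 ^ (B * M) := by ring
        _ ≤ 2 ^ B * 2 ^ (B * M) := Nat.mul_le_mul_right _ h2

/-- **Reading a slot off the digits**: if all packed digits are `< 2^B`, the `m`-th base-`2^B` digit of
`kpack B M d` is `d_m` (`m < M`), else `0`. [cite: GathenGerhard2013ModernComputerAlgebra, §8.4 (the coefficients of h can be read off the 2^{64t}-adic representation)] -/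
theorem kdigit_kpack {B M : ℕ} {d : ℕ → ℕ} (hd : ∀ j < M, d j < 2 ^ B) (m : ℕ) :
    kdigit B (kpack B M d) m = if m < M then d m else 0 := by
  unfold kdigit
  split_ifs with hm
  · obtain ⟨r, rfl⟩ : ∃ r, M = m + (1 + r) := ⟨M - m - 1, by omega⟩
    have hdm : d m < 2 ^ B := hd m (by omega)
    rw [kpack_add, Nat.add_mul_div_left _ _ (by positivity),
      Nat.div_eq_of_lt (kpack_lt fun j hj => hd j (by omega)), zero_add, kpack_add]
    simp only [kpack_succ, kpack_zero, mul_zero, pow_zero, mul_one, zero_add, add_zero]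
    rw [Nat.add_mul_mod_self_left, Nat.mod_eq_of_lt hdm]
  · rw [Nat.div_eq_of_lt, Nat.zero_mod]
    exact (kpack_lt hd).trans_le (Nat.pow_le_pow_right (by norm_num) (Nat.mul_le_mul_left _ (not_lt.1 hm)))

/-- **Kronecker substitution**: the product of two packed vectors is the packed integer product formula,
`kpack B M d · kpack B M e = kpack B (2M) (d↾M ⋆ e↾M)` (i.e. `f(2^B) g(2^B) = h(2^B)`, unconditionally).
[cite: GathenGerhard2013ModernComputerAlgebra, §8.4 (Kronecker substitution)] -/
theorem kpack_mul_kpack (B M : ℕ) (d e : ℕ → ℕ) :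
    kpack B M d * kpack B M e = kpack B (2 * M) (dconvNat (truncSeq M d) (truncSeq M e)) := by
  unfold kpack dconvNat
  rw [Finset.sum_mul_sum]
  simp_rw [Finset.sum_mul]
  rw [sum_antidiagonal_truncSeq_eq d e (fun m => 2 ^ (B * m)) M]
  refine Finset.sum_congr rfl fun i _ => Finset.sum_congr rfl fun j _ => ?_
  ring

/-- Reading the coefficients of the product off the digits when there are no carries (all `(d↾M ⋆ e↾M)_m < 2^B`).
[cite: GathenGerhard2013ModernComputerAlgebra, §8.4 (Kronecker substitution)] -/
theorem kdigit_kpack_mul_kpack {B M : ℕ} {d e : ℕ → ℕ}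
    (h : ∀ m < 2 * M, dconvNat (truncSeq M d) (truncSeq M e) m < 2 ^ B) (m : ℕ) :
    kdigit B (kpack B M d * kpack B M e) m =
      if m < 2 * M then dconvNat (truncSeq M d) (truncSeq M e) m else 0 := by
  rw [kpack_mul_kpack]
  exact kdigit_kpack h m

/-- A sufficient no-carry condition: `(Σ_{j<M} d_j)(Σ_{j<M} e_j) < 2^B`.
[cite: GathenGerhard2013ModernComputerAlgebra, §8.4 (Kronecker substitution)] -/
theorem kdigit_kpack_mul_kpack_of_sum_mul_sum_lt {B M : ℕ} {d e : ℕ → ℕ}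
    (h : (∑ i ∈ range M, d i) * (∑ j ∈ range M, e j) < 2 ^ B) (m : ℕ) :
    kdigit B (kpack B M d * kpack B M e) m =
      if m < 2 * M then dconvNat (truncSeq M d) (truncSeq M e) m else 0 :=
  kdigit_kpack_mul_kpack (fun m _ => (dconvNat_truncSeq_le d e M m).trans_lt h) m

/-- **Keeping the low slots**: reduction mod `2^{BM}` truncates a packed vector to its first `M` slots (digits of
those slots `< 2^B`). [cite: GathenGerhard2013ModernComputerAlgebra, §8.4 (Kronecker substitution)] -/
theorem kpack_mod_two_pow {B M M' : ℕ} {d : ℕ → ℕ} (hM : M ≤ M') (hd : ∀ j < M, d j < 2 ^ B) :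
    kpack B M' d % 2 ^ (B * M) = kpack B M d := by
  obtain ⟨r, rfl⟩ : ∃ r, M' = M + r := ⟨M' - M, by omega⟩
  rw [kpack_add, Nat.add_mul_mod_self_left, Nat.mod_eq_of_lt (kpack_lt hd)]

/-- `2^B ≡ 1 (mod 2^B − 1)`. [cite: GathenGerhard2013ModernComputerAlgebra, §4.1 (modular arithmetic)] -/
theorem two_pow_modEq_one (B : ℕ) : 2 ^ B ≡ 1 [MOD 2 ^ B - 1] :=
  ((Nat.modEq_iff_dvd' Nat.one_le_two_pow).2 (dvd_refl _)).symm

/-- **Digit sums by one reduction**: `kpack B M c ≡ Σ_{m<M} c_m (mod 2^B − 1)` (the value at `x = 2^B` reduced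
modulo `2^B − 1` is the value at `x = 1`). [cite: GathenGerhard2013ModernComputerAlgebra, §4.1 (modular arithmetic; here 2^B ≡ 1)] -/
theorem kpack_modEq_sum (B M : ℕ) (c : ℕ → ℕ) :
    kpack B M c ≡ ∑ m ∈ range M, c m [MOD 2 ^ B - 1] := by
  induction M with
  | zero => simp only [kpack_zero, Finset.sum_range_zero]; exact Nat.ModEq.refl _
  | succ M ih =>
      rw [kpack_succ, Finset.sum_range_succ]
      refine ih.add ?_
      have h1 : 2 ^ (B * M) ≡ 1 [MOD 2 ^ B - 1] := by
        rw [pow_mul]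
        simpa using (two_pow_modEq_one B).pow M
      simpa using h1.mul_left (c M)

/-- If `Σ_{m<M} c_m < 2^B − 1`, the digit sum IS the remainder: `kpack B M c mod (2^B − 1) = Σ_{m<M} c_m`.
[cite: GathenGerhard2013ModernComputerAlgebra, §4.1 (modular arithmetic; here 2^B ≡ 1)] -/
theorem kpack_mod_eq_sum {B M : ℕ} {c : ℕ → ℕ} (h : ∑ m ∈ range M, c m < 2 ^ B - 1) :
    kpack B M c % (2 ^ B - 1) = ∑ m ∈ range M, c m := by
  have h1 : kpack B M c % (2 ^ B - 1) = (∑ m ∈ range M, c m) % (2 ^ B - 1) := kpack_modEq_sum B M c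
  rw [h1, Nat.mod_eq_of_lt h]

/-- Partial sums of a packed vector with digits `< 2^B`: `Σ_{m<M} c_m = (kpack B M' c mod 2^{BM}) mod (2^B − 1)` when
`M ≤ M'` and `Σ_{m<M} c_m < 2^B − 1` — two big-integer remainders. [cite: GathenGerhard2013ModernComputerAlgebra, §8.4 (Kronecker substitution)] -/
theorem sum_eq_kpack_mod_mod {B M M' : ℕ} {c : ℕ → ℕ} (hM : M ≤ M') (hc : ∀ j < M, c j < 2 ^ B)
    (h : ∑ m ∈ range M, c m < 2 ^ B - 1) :
    ∑ m ∈ range M, c m = kpack B M' c % 2 ^ (B * M) % (2 ^ B - 1) := by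
  rw [kpack_mod_two_pow hM hc, kpack_mod_eq_sum h]

end Kronecker

/-! ### Digitwise operations on packed vectors (bit level): the periodic-mask renormalisation -/

section Digitwise

/-- **Bits of a packed vector** (digits `< 2^B`, `B > 0`): bit `i` of `kpack B M d` is bit `i mod B` of the digit
`d_{⌊i/B⌋}` (and `0` beyond the `M` slots). [cite: GathenGerhard2013ModernComputerAlgebra, §8.4 (the 2^{64t}-adic representation)] -/
theorem testBit_kpack {B M : ℕ} {d : ℕ → ℕ} (hB : 0 < B) (hd : ∀ j < M, d j < 2 ^ B) (i : ℕ) :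
    (kpack B M d).testBit i = if i / B < M then (d (i / B)).testBit (i % B) else false := by
  induction M generalizing d i with
  | zero => simp
  | succ M ih =>
      rw [kpack_succ', Nat.testBit_two_pow_mul_add _ (hd 0 (by omega))]
      by_cases hi : i < B
      · rw [if_pos hi, Nat.div_eq_of_lt hi, Nat.mod_eq_of_lt hi, if_pos (by omega)]
      · obtain ⟨i, rfl⟩ : ∃ i', i = i' + B := ⟨i - B, by omega⟩
        rw [if_neg (by omega), Nat.add_sub_cancel, ih (fun j hj => hd (1 + j) (by omega)),
          Nat.add_div_right _ hB, Nat.add_mod_right]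
        by_cases h : i / B < M
        · rw [if_pos h, if_pos (Nat.succ_lt_succ h), add_comm]
        · rw [if_neg h, if_neg fun h' => h (Nat.lt_of_succ_lt_succ h')]

/-- Bits of the **periodic mask** `Σ_{m<M} (2^w − 1) 2^{Bm}` (`w ≤ B`, `B > 0`): bit `i` is set iff `⌊i/B⌋ < M` and
`i mod B < w`. [cite: GathenGerhard2013ModernComputerAlgebra, §8.4 (the 2^{64t}-adic representation)] -/
theorem testBit_kpack_const_mask {B M w : ℕ} (hB : 0 < B) (hw : w ≤ B) (i : ℕ) :
    (kpack B M (fun _ => 2 ^ w - 1)).testBit i = (decide (i / B < M) && decide (i % B < w)) := by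
  have hdig : ∀ j < M, (fun _ : ℕ => 2 ^ w - 1) j < 2 ^ B := fun _ _ =>
    Nat.sub_one_lt_of_le (Nat.two_pow_pos w) (Nat.pow_le_pow_right (by norm_num) hw)
  rw [testBit_kpack hB hdig i, Nat.testBit_two_pow_sub_one]
  by_cases h : i / B < M <;> simp [h]

/-- **Periodic-mask renormalisation = digitwise division.**  For a packed vector with digits `c_m < 2^B`
(`m < M`), `0 < B` (and `L ≤ B` in every use): shifting right by `L` bits and AND-ing with the periodic mask `Σ_{m<M} (2^{B−L} − 1) 2^{Bm}`
divides EVERY slot by `2^L` (rounding down): `((kpack B M c) >>> L) &&& mask = kpack B M (⌊c_m/2^L⌋)_m` — one shift and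
one AND of big integers. (Rounding up: first add `kpack B M (2^L − 1)` by `kpack_add_kpack`, digits permitting.)
[cite: GathenGerhard2013ModernComputerAlgebra, §8.4 (the coefficients of h can be read off the 2^{64t}-adic representation)] -/
theorem shiftRight_kpack_land_mask {B L M : ℕ} {c : ℕ → ℕ} (hB : 0 < B)
    (hc : ∀ m < M, c m < 2 ^ B) :
    (kpack B M c >>> L) &&& kpack B M (fun _ => 2 ^ (B - L) - 1) = kpack B M (fun m => c m / 2 ^ L) := by
  refine Nat.eq_of_testBit_eq fun i => ?_
  have hc' : ∀ m < M, (fun m => c m / 2 ^ L) m < 2 ^ B := fun m hm =>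
    lt_of_le_of_lt (Nat.div_le_self _ _) (hc m hm)
  rw [Nat.testBit_and, Nat.testBit_shiftRight, testBit_kpack hB hc, testBit_kpack_const_mask hB (Nat.sub_le B L),
    testBit_kpack hB hc' i]
  simp only [Nat.testBit_div_two_pow]
  have hdm := Nat.div_add_mod i B
  have hmod : i % B < B := Nat.mod_lt i hB
  by_cases ht : i % B < B - L
  · have hlt : i % B + L < B := Nat.lt_sub_iff_add_lt.1 ht
    have h1 : L + i = B * (i / B) + (i % B + L) := by rw [← add_assoc, hdm, add_comm]
    have h2 : (L + i) / B = i / B := by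
      rw [h1, Nat.mul_add_div hB, Nat.div_eq_of_lt hlt, add_zero]
    have h3 : (L + i) % B = i % B + L := by
      rw [h1, Nat.mul_add_mod, Nat.mod_eq_of_lt hlt]
    rw [h2, h3]
    by_cases hm : i / B < M <;> simp [hm, ht]
  · have hle : B ≤ i % B + L := Nat.sub_le_iff_le_add.1 (not_lt.1 ht)
    have hfalse : ∀ m < M, (c m).testBit (i % B + L) = false := fun m hm =>
      Nat.testBit_lt_two_pow ((hc m hm).trans_le (Nat.pow_le_pow_right (by norm_num) hle))
    by_cases hm : i / B < M
    · simp [hm, ht, hfalse _ hm]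
    · simp [hm]

end Digitwise

/-! ### One addition-chain step as big-integer operations -/

section ChainStep

/-- `kpack B M` only reads the slots `< M`. [cite: GathenGerhard2013ModernComputerAlgebra, §8.4 (Kronecker substitution)] -/
theorem kpack_congr {B M : ℕ} {f g : ℕ → ℕ} (h : ∀ m < M, f m = g m) : kpack B M f = kpack B M g :=
  Finset.sum_congr rfl fun m hm => by rw [h m (Finset.mem_range.1 hm)]

/-- Rounding up never costs more than one unit per slot: `⌈x/E⌉ ≤ ⌊x/E⌋ + 1`.
[cite: GathenGerhard2013ModernComputerAlgebra, §2.4 (division with remainder)] -/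
theorem ceilDiv_le_div_add_one (x : ℕ) {E : ℕ} (hE : 0 < E) : (x + E - 1) / E ≤ x / E + 1 := by
  calc (x + E - 1) / E ≤ (x + E) / E := Nat.div_le_div_right (Nat.sub_le _ _)
    _ = x / E + 1 := Nat.add_div_right x hE

/-- `Σ_{m<M} ⌊x_m/E⌋ ≤ ⌊(Σ_{m<M} x_m)/E⌋`. [cite: GathenGerhard2013ModernComputerAlgebra, §2.4 (division with remainder)] -/
theorem sum_div_le_sum_div (x : ℕ → ℕ) {E : ℕ} (hE : 0 < E) (M : ℕ) :
    ∑ m ∈ range M, x m / E ≤ (∑ m ∈ range M, x m) / E := by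
  rw [Nat.le_div_iff_mul_le hE, Finset.sum_mul]
  exact Finset.sum_le_sum fun m _ => Nat.div_mul_le_self (x m) E

/-- **A-priori mass bound after rounding up**: `Σ_{m<M} ⌈x_m/E⌉ ≤ ⌊(Σ_{m<M} x_m)/E⌋ + M`.
[cite: GathenGerhard2013ModernComputerAlgebra, §2.4 (division with remainder)] -/
theorem sum_ceilDiv_le (x : ℕ → ℕ) {E : ℕ} (hE : 0 < E) (M : ℕ) :
    ∑ m ∈ range M, (x m + E - 1) / E ≤ (∑ m ∈ range M, x m) / E + M := by
  calc ∑ m ∈ range M, (x m + E - 1) / E ≤ ∑ m ∈ range M, (x m / E + 1) :=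
        Finset.sum_le_sum fun m _ => ceilDiv_le_div_add_one (x m) hE
    _ = ∑ m ∈ range M, x m / E + M := by rw [Finset.sum_add_distrib, Finset.sum_const, Finset.card_range, smul_eq_mul, mul_one]
    _ ≤ (∑ m ∈ range M, x m) / E + M := Nat.add_le_add_right (sum_div_le_sum_div x hE M) M

variable {B L M : ℕ} {u v : ℕ → ℕ}

/-- **One chain step, rounding DOWN, as three big-integer operations** (product, truncation `mod 2^{BM}`, shift-and-mask):
if `(Σ_{j<M} u_j)(Σ_{j<M} v_j) < 2^B` (no carries) then
`(((kpack u)·(kpack v)) mod 2^{BM}) >>> L &&& mask = kpack B M (⌊(u ⋆ v)_m/2^L⌋)_m`.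
[cite: GathenGerhard2013ModernComputerAlgebra, §8.4 (Kronecker substitution)] -/
theorem kpack_mul_step_floor (hB : 0 < B) (hprod : (∑ i ∈ range M, u i) * (∑ j ∈ range M, v j) < 2 ^ B) :
    ((kpack B M u * kpack B M v % 2 ^ (B * M)) >>> L) &&& kpack B M (fun _ => 2 ^ (B - L) - 1) =
      kpack B M (fun m => dconvNat u v m / 2 ^ L) := by
  have hdig : ∀ m < M, dconvNat (truncSeq M u) (truncSeq M v) m < 2 ^ B := fun m _ =>
    (dconvNat_truncSeq_le u v M m).trans_lt hprod
  rw [kpack_mul_kpack, kpack_mod_two_pow (by omega : M ≤ 2 * M) hdig, shiftRight_kpack_land_mask hB hdig]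
  exact kpack_congr fun m hm => by rw [dconvNat_truncSeq_of_lt u v hm]

/-- **One chain step, rounding UP, as four big-integer operations** (product, truncation, addition of the periodic constant
`Σ_m (2^L − 1) 2^{Bm}`, shift-and-mask): if `(Σ_{j<M} u_j)(Σ_{j<M} v_j) + 2^L ≤ 2^B` then
`((((kpack u)·(kpack v)) mod 2^{BM} + kpack B M (2^L − 1)) >>> L) &&& mask = kpack B M (⌈(u ⋆ v)_m/2^L⌉)_m`,
`⌈x/2^L⌉ = (x + 2^L − 1)/2^L` as in `dconvPow_add_le_ceilDiv`. [cite: GathenGerhard2013ModernComputerAlgebra, §8.4 (Kronecker substitution)] -/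
theorem kpack_mul_step_ceil (hB : 0 < B) (hprod : (∑ i ∈ range M, u i) * (∑ j ∈ range M, v j) + 2 ^ L ≤ 2 ^ B) :
    ((kpack B M u * kpack B M v % 2 ^ (B * M) + kpack B M (fun _ => 2 ^ L - 1)) >>> L) &&&
        kpack B M (fun _ => 2 ^ (B - L) - 1) =
      kpack B M (fun m => (dconvNat u v m + 2 ^ L - 1) / 2 ^ L) := by
  have hL1 : 1 ≤ 2 ^ L := Nat.one_le_two_pow
  have hdig : ∀ m < M, dconvNat (truncSeq M u) (truncSeq M v) m < 2 ^ B := fun m _ =>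
    lt_of_le_of_lt (dconvNat_truncSeq_le u v M m) (by omega)
  have hdig' : ∀ m < M, (fun m => dconvNat u v m + (2 ^ L - 1)) m < 2 ^ B := fun m hm => by
    have := dconvNat_le_sum_mul_sum u v hm
    simp only
    omega
  rw [kpack_mul_kpack, kpack_mod_two_pow (by omega : M ≤ 2 * M) hdig,
    kpack_congr fun m hm => dconvNat_truncSeq_of_lt u v hm, kpack_add_kpack,
    shiftRight_kpack_land_mask hB hdig']
  exact kpack_congr fun m _ => by rw [Nat.add_sub_assoc hL1]

/-- The slot sums after a rounding-down step: `Σ_{m<M} ⌊(u ⋆ v)_m/2^L⌋ ≤ ⌊(Σu)(Σv)/2^L⌋`.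
[cite: GathenGerhard2013ModernComputerAlgebra, §8.4 (Kronecker substitution)] -/
theorem sum_floorStep_le (u v : ℕ → ℕ) (L M : ℕ) :
    ∑ m ∈ range M, dconvNat u v m / 2 ^ L ≤ (∑ i ∈ range M, u i) * (∑ j ∈ range M, v j) / 2 ^ L :=
  (sum_div_le_sum_div _ (Nat.two_pow_pos L) M).trans (Nat.div_le_div_right (sum_dconvNat_le u v M))

/-- The slot sums after a rounding-up step: `Σ_{m<M} ⌈(u ⋆ v)_m/2^L⌉ ≤ ⌊(Σu)(Σv)/2^L⌋ + M`.
[cite: GathenGerhard2013ModernComputerAlgebra, §8.4 (Kronecker substitution)] -/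
theorem sum_ceilStep_le (u v : ℕ → ℕ) (L M : ℕ) :
    ∑ m ∈ range M, (dconvNat u v m + 2 ^ L - 1) / 2 ^ L ≤
      (∑ i ∈ range M, u i) * (∑ j ∈ range M, v j) / 2 ^ L + M :=
  (sum_ceilDiv_le _ (Nat.two_pow_pos L) M).trans
    (Nat.add_le_add_right (Nat.div_le_div_right (sum_dconvNat_le u v M)) M)

end ChainStep

/-! ### Divide-and-conquer packing (the initial vector in `O(M log M)` big-integer work) -/

section PackTree

/-- **Divide-and-conquer Kronecker packing**: `kpackDC B d e o` packs the `2^e` slots `o, …, o + 2^e − 1` of `d`,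
splitting in halves and combining with one shift and one addition (so that a vector of `M = 2^e` slots is packed with
`O(M log M)`-bit work instead of the `O(M²)` of the defining sum). [cite: GathenGerhard2013ModernComputerAlgebra, §8.4 (Kronecker substitution)] -/
def kpackDC (B : ℕ) (d : ℕ → ℕ) : ℕ → ℕ → ℕ
  | 0, o => d o
  | e + 1, o => kpackDC B d e o + (kpackDC B d e (o + 2 ^ e) <<< (B * 2 ^ e))

/-- `kpackDC` computes `kpack`: `kpackDC B d e o = kpack B (2^e) (d(o+·))`. [cite: GathenGerhard2013ModernComputerAlgebra, §8.4 (Kronecker substitution)] -/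
theorem kpackDC_eq (B : ℕ) (d : ℕ → ℕ) : ∀ e o : ℕ, kpackDC B d e o = kpack B (2 ^ e) (fun i => d (o + i))
  | 0, o => by simp [kpackDC]
  | e + 1, o => by
      rw [kpackDC, kpackDC_eq B d e o, kpackDC_eq B d e (o + 2 ^ e), Nat.shiftLeft_eq, pow_succ, mul_two,
        kpack_add, mul_comm (2 ^ (B * 2 ^ e))]
      simp only [add_assoc]

/-- The packed initial vector of `M = 2^e` slots: `kpackDC B d e 0 = kpack B (2^e) d`.
[cite: GathenGerhard2013ModernComputerAlgebra, §8.4 (Kronecker substitution)] -/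
theorem kpackDC_zero_eq (B : ℕ) (d : ℕ → ℕ) (e : ℕ) : kpackDC B d e 0 = kpack B (2 ^ e) d := by
  rw [kpackDC_eq]
  simp only [zero_add]

end PackTree

/-! ### Block-constant weights against a packed vector -/

section Blocks

/-- **Regrouping a block-constant weight**: `Σ_{m < rW} c(⌊m/W⌋) w_m = Σ_{i<r} c_i · Σ_{t<W} w_{iW+t}` — a weighted slot sum
with weights constant on `r` blocks of width `W` costs `r` block sums, i.e. `r + 1` partial sums of the packed vector
(`sum_eq_kpack_mod_mod` with `Finset.sum_range_add`). [cite: GathenGerhard2013ModernComputerAlgebra, §8.4 (Kronecker substitution)] -/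
theorem sum_range_mul_blockConst {R : Type*} [CommSemiring R] (c w : ℕ → R) (W r : ℕ) :
    ∑ m ∈ range (r * W), c (m / W) * w m = ∑ i ∈ range r, c i * ∑ t ∈ range W, w (i * W + t) := by
  induction r with
  | zero => simp
  | succ r ih =>
      rw [Nat.succ_mul, Finset.sum_range_add, ih, Finset.sum_range_succ, Finset.mul_sum]
      congr 1
      refine Finset.sum_congr rfl fun t ht => ?_
      rw [Finset.mem_range] at ht
      have hW : 0 < W := by omega
      rw [show (r * W + t) / W = r by
        rw [Nat.add_comm, Nat.add_mul_div_right _ _ hW, Nat.div_eq_of_lt ht, zero_add]]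

end Blocks

end Literature.Analysis.Convolution
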